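import Summits.ResolutionOfSingularities.ResolutionOfSingularities.Theorems.PPowerSpan
import HarnessLib

/-!
# KangarooTransport — decomp-res node «KangarooCut» (lens-4 g24, critic rows 148/148a), tree file 2/5 of the node

Content VERBATIM from the decomp-res lens-4 g24 TREE-FACING COMPANION
`HOME/decomp-res-lens-4/g24/tree/KangarooCutTree.lean` (sha256 76e53063…, 770 l;
HOME = run/shared/lean/pub/decomp-res) = the NEW PART §60–§63 of the node
`HOME/decomp-res-lens-4/g24/KangarooCut.lean` (pin f422af60, l. 1026–1759, byte-identical);
the node's carried g23 block «FrobeniusForm» is ALREADY in the tree as `Theorems/FrobeniusGain` ·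
`PPowerFormLucas` · `PPowerForm` · `PPowerTowers` and is not
landed again.  Critic: CRITIC-LEDGER rows 148 (CLEARED, DECIDED +1: the jump-free bed ⊆ `ContactHugging`) and 148a
(the companion = the landing unit); landing
order 2026-08-30T22:00:50Z / 22:19:25Z.  Landed by decomp-res writer g8 in the lens's namespace
`…Theorems.HugValuationCut`, split CONE-AWARE for the
400-line limit: `PPowerSpan` (§60) · `KangarooTransport` (§61) · `KangarooTowers` (§62) · `KangarooCutCells`
(§63 minus the three 31571 up-links) are
OUTSIDE the Theses cone (importable by the route file); `MaxContactCutKangarooCut` (§63's three `_of_item` up-links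
from `MaxContactCut.NoContactHuggingTowers`)
is the in-cone wiring file.  All `--supports stmt-ResolutionOfSingularities-28338`.  Aside bookkeeping (critic row
148 / rider 22:00:50Z (3)): exactly ONE
successor aside `NoWildKangarooOffLocusTowers` (home `KangarooCutCells`) SUPERSEDES 28338
`LCNoWildContactFreeOffLocusTowers` once this node and
`Theorems/ContactFreeIsPPower` (lens-6 g19 companion, every-field iff `noWildContactFreeOffLocusTowers_iff_pPower`)
are both in the tree — exactness chain
`noWildContactFreeOffLocusTowers_iff_pPower` + `noWildPPowerOffLocusTowers_iff_kangaroo (h31571)`.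

§61 (companion l. 131–345) THE TRANSPORT LAW OF WEAK CONTACT UNDER ONE POINT BLOW-UP, scheme level: `WInv`,
`TailJumpAt`, `WeakContactAt`, `ShapeAt`,
`wInv_point_transport`, `wInv_or_tailJumpAt_point`, `mem_support_of_wInv`, `idealOrder_eq_one_of_wInv` (KERNEL,
PROVED, 0 sorry; uses the tree's
`AbsoluteContactClasses.point_round_chart`).  Imports `PPowerSpan`.  Cone-free.

[WRITER NOTE (decomp-res writer g8): section split only; namespace, universes, section variables and every
declaration exactly as in the companion
(global `set_option` dropped; the cone import `MaxContactCutTameCut` of the companion is replaced in the cone-free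
files by the cone-free homes of what the
proofs use: `AbsoluteGiraudKernel` (`AbsoluteContactClasses.point_round_chart`),
`FrobeniusLadderFInjectiveMacaulayficationCentreSpread` (`centreSpread`),
`PPowerTowers`, `TameCutStage`, `LatencyCutCells`; the `open …Theses` line lives only in the wiring file).]

(Sources: Hauser2010Kangaroo; Moh1987; Hironaka1970Additive; Giraud1975; CossartPiltant2008 Prop. 4.2;
CossartPiltant2019 Prop. 2.50; EGA IV₄ 16.11.2.)
-/

noncomputable section

open CategoryTheory AlgebraicGeometry IsLocalRing
open Literature.AlgebraicGeometry.Resolution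
open Summit.ResolutionOfSingularities.ResolutionOfSingularities.Theorems
open WeakOrderReduction ForcedTowerClasses DivergentTowerClasses MonomialTowerClasses
open HugDimensionClasses HugDimensionKernels SurfaceShadowClasses SurfaceShadowKernels
open NearPointCut (SingularClass)
open AbsoluteContactClasses (IsAbsContactAt SepResidueAt diffIdeal_restrict_le stalkMap_comp_toStalk_eq_stalkHom)
open scoped BigOperators

namespace Summit.ResolutionOfSingularities.ResolutionOfSingularities.Theorems.HugValuationCut

/-! ## §61 (g24 · NEW · KERNEL) THE TRANSPORT LAW OF WEAK CONTACT UNDER ONE POINT BLOW-UP — scheme level, any weight `n`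

Blow up the regular locally Noetherian `X` in the closed point `x = π y` and let `𝓘' = (π^{-1}𝓘 : E^n)` be
the controlled
transform of an ideal of order `≥ n` at `x`.  If `H_x = (z)` with `z` a regular parameter and `f − c·z^n ∈
𝔪_x^{n+1}` for some
`f ∈ 𝓘_x`, `c` a unit (the degree-`n` initial form of `f` is `c̄·Z^n`), then in `𝒪_{X',y}`: `π^*z =
t·z'`, `E_y = (t)`,
`π^*f = t^n·w` with `w ∈ 𝓘'_y` and `w − π^*c · z'^n ∈ (t)`.  CONSEQUENCES wherever `𝓘'_y ⊆ 𝔪_y`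
(the order did not drop to
`0`, e.g. at the next point of a forced tower): `z' ∈ 𝔪_y`, i.e. `y ∈ V(H')` — THE NEXT POINT LIES ON THE
STRICT TRANSFORM OF
THE WEAK-CONTACT HYPERSURFACE, unconditionally — `z'` is again a regular parameter, `H'_y = (z')`, and the new tail
`w − c'·z'^n` is exceptionally divisible: EITHER it lies in `𝔪_y^{n+1}` (the invariant PERSISTS: no jump) OR it does not
(A KANGAROO JUMP at `y`, typed `TailJumpAt`).  (Hauser2010Kangaroo: the transform of the weak-contact hypersurface contains the
equiconstant points; the residual order of the tail may only misbehave at kangaroo points.) -/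

section WeakTransport

universe uW

variable {X X' : Scheme.{uW}} {π : X' ⟶ X} {C : X.IdealSheafData}

/-- **`WInv 𝓘 H n y` — THE WEAK-CONTACT STAGE INVARIANT** (NEW OBJECT of this node): `H_y = (z)` with `z` a
REGULAR PARAMETER
(`z ∈ 𝔪_y ∖ 𝔪_y²`) and some `f ∈ 𝓘_y` is a unit multiple of `z^n` to order `n + 1` (`f − c·z^n
∈ 𝔪_y^{n+1}`, `c` a unit: the
degree-`n` initial form of `f` is `c̄·Z^n`).  For `n = p = char κ(y)` this is WEAK CONTACT of the regular hypersurface germ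
`V(H)` with `𝓘` at `y`. DEFINITION (support). -/
def WInv {Y : Scheme.{uW}} (I H : Y.IdealSheafData) (n : ℕ) (y : Y) : Prop :=
  ∃ z : Y.presheaf.stalk y, stalkIdeal H y = Ideal.span {z} ∧ z ∈ maximalIdeal (Y.presheaf.stalk y) ∧
    z ∉ maximalIdeal (Y.presheaf.stalk y) ^ 2 ∧
    ∃ f ∈ stalkIdeal I y, ∃ c : Y.presheaf.stalk y, IsUnit c ∧
      f - c * z ^ n ∈ maximalIdeal (Y.presheaf.stalk y) ^ (n + 1)

/-- **`TailJumpAt 𝓘 H E n y` — A KANGAROO JUMP AT `y`, TYPED** (NEW OBJECT): `H_y = (z')` with `z'` a regular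
parameter through
`y`, and some `w ∈ 𝓘_y`, `c'` a unit, have their `z'^n`-TAIL `w − c'·z'^n` inside the exceptional ideal
`E_y` but NOT inside
`𝔪_y^{n+1}` — the residual order of the transported tail has dropped to the weight (Hauser's kangaroo jump, by letter).
DEFINITION (support). -/
def TailJumpAt {Y : Scheme.{uW}} (I H E : Y.IdealSheafData) (n : ℕ) (y : Y) : Prop :=
  ∃ z' : Y.presheaf.stalk y, stalkIdeal H y = Ideal.span {z'} ∧ z' ∈ maximalIdeal (Y.presheaf.stalk y) ∧
    z' ∉ maximalIdeal (Y.presheaf.stalk y) ^ 2 ∧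
    ∃ w ∈ stalkIdeal I y, ∃ c' : Y.presheaf.stalk y, IsUnit c' ∧ w - c' * z' ^ n ∈ stalkIdeal E y ∧
      w - c' * z' ^ n ∉ maximalIdeal (Y.presheaf.stalk y) ^ (n + 1)

/-- **`WeakContactAt n 𝓘 y` — WEAK CONTACT AT `y` IN WEIGHT `n`** (NEW TYPED PREDICATE, point level, no germ ideal): some
REGULAR PARAMETER `z ∈ 𝔪_y ∖ 𝔪_y²` and some `f ∈ 𝓘_y`, `c` a unit, with `f − c·z^n ∈
𝔪_y^{n+1}` — the degree-`n` initial form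
of `f` is `c̄·Z^n`, the `n`-th power of ONE LINEAR FORM.  For `n = p = char κ(y)` at a point of order `p` this is
Hironaka–Hauser
WEAK CONTACT of the regular hypersurface germ `z = 0`. DEFINITION (support). -/
def WeakContactAt {Y : Scheme.{uW}} (n : ℕ) (I : Y.IdealSheafData) (y : Y) : Prop :=
  ∃ z ∈ maximalIdeal (Y.presheaf.stalk y), z ∉ maximalIdeal (Y.presheaf.stalk y) ^ 2 ∧
    ∃ f ∈ stalkIdeal I y, ∃ c : Y.presheaf.stalk y, IsUnit c ∧ f - c * z ^ n ∈ maximalIdeal (Y.presheaf.stalk y) ^ (n + 1)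

/-- the stage invariant along a germ gives weak contact at the point. [folklore] -/
theorem weakContactAt_of_wInv {Y : Scheme.{uW}} {I H : Y.IdealSheafData} {n : ℕ} {y : Y} (h : WInv I H n y) :
    WeakContactAt n I y := by
  obtain ⟨z, -, hzm, hz2, f, hfI, c, hc, hfz⟩ := h
  exact ⟨z, hzm, hz2, f, hfI, c, hc, hfz⟩

/-- **`ShapeAt 𝓘 H n y` — THE CENSUS LETTER «in_n = c̄·Z^n IN THE TRANSPORTED COORDINATE»** (NEW TYPED
PREDICATE): for ANY
local equation `z'` of the germ (`H_y = (z')`), some `f ∈ 𝓘_y` is a unit multiple of `z'^n` to order `n + 1`.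
Nothing about
`z'` itself is asked (not `z' ∈ 𝔪_y`, not `z' ∉ 𝔪_y²`): along a transported weak-contact germ the
transport law UPGRADES the
letter to the full invariant (`wInv_succ_of_shapeAt`). DEFINITION (support). -/
def ShapeAt {Y : Scheme.{uW}} (I H : Y.IdealSheafData) (n : ℕ) (y : Y) : Prop :=
  ∀ z' : Y.presheaf.stalk y, stalkIdeal H y = Ideal.span {z'} →
    ∃ f ∈ stalkIdeal I y, ∃ c : Y.presheaf.stalk y, IsUnit c ∧ f - c * z' ^ n ∈ maximalIdeal (Y.presheaf.stalk y) ^ (n + 1)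

/-- the invariant gives the letter (any two local equations of the germ differ by a unit: `(1 − ba)·z = 0`, `z ≠ 0`, local
ring). [folklore] -/
theorem shapeAt_of_wInv {Y : Scheme.{uW}} {I H : Y.IdealSheafData} {n : ℕ} {y : Y} (h : WInv I H n y) :
    ShapeAt I H n y := by
  obtain ⟨z, hHz, hzm, hz2, f, hfI, c, hc, hfz⟩ := h
  intro z' hHz'
  have h1 : z' ∈ Ideal.span {z} := by rw [← hHz, hHz']; exact Ideal.mem_span_singleton_self _
  have h2 : z ∈ Ideal.span {z'} := by rw [← hHz', hHz]; exact Ideal.mem_span_singleton_self _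
  obtain ⟨a, ha⟩ := Ideal.mem_span_singleton'.mp h1
  obtain ⟨b, hb⟩ := Ideal.mem_span_singleton'.mp h2
  have hz0 : z ≠ 0 := fun h0 => hz2 (by rw [h0]; exact zero_mem _)
  have hba : IsUnit (b * a) := by
    by_contra hna
    have hu : IsUnit (1 - b * a) := isUnit_one_sub_self_of_mem_nonunits _ (mem_nonunits_iff.mpr hna)
    have h0 : (1 - b * a) * z = 0 := by rw [sub_mul, one_mul, mul_assoc, ha, hb, sub_self]
    exact hz0 (hu.mul_right_eq_zero.mp h0)
  obtain ⟨u, hu⟩ := isUnit_of_mul_isUnit_right hba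
  refine ⟨f, hfI, c * (↑u⁻¹ : Y.presheaf.stalk y) ^ n, hc.mul ((Units.isUnit _).pow n), ?_⟩
  have e : c * (↑u⁻¹ : Y.presheaf.stalk y) ^ n * z' ^ n = c * z ^ n := by
    rw [← ha, ← hu, mul_pow, mul_assoc, ← mul_assoc ((↑u⁻¹ : Y.presheaf.stalk y) ^ n), ← mul_pow, Units.inv_mul,
      one_pow, one_mul]
  rw [e]
  exact hfz

/-- **THE TRANSPORT LAW OF WEAK CONTACT (KERNEL, PROVED), point round.** `π` the blowing up of the regular locally Noetherian
`X` in the closed point `x = π y` (`V(C) = {x}`, `V(C)` regular), `𝓘_x ⊆ 𝔪_x^n`, `𝓘'_y ⊆ 𝔪_y` for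
`𝓘' = (π^{-1}𝓘 : E^n)`, and
`WInv 𝓘 H n x`.  Then `y` LIES ON THE STRICT TRANSFORM `H'` of `H`, `H'_y = (z')` with `z'` a regular parameter, and some
`w ∈ 𝓘'_y`, `c'` a unit, have `w − c'·z'^n ∈ 𝓘(E)_y`: the point round `π^*z = t·z'` of the tree's
`point_round_chart` and the
colon-ideal calculus `𝓘'_y = (π^*𝓘_x : t^n)`, `π^*𝔪_x^{n+1} = (t^{n+1})`, `t` a non-zero-divisor.
(Sources: Hauser2010Kangaroo;
EncinasVillamayor2000, Thm. 4.9; StacksProject, Tag 0BIQ; BierstoneGrigorievMilmanWlodarczyk2011, §3.2.) -/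
theorem wInv_point_transport (hπ : IsBlowup π C) [IsLocallyNoetherian X] [IsLocallyNoetherian X']
    (hX : Scheme.IsRegular X) (hCreg : Scheme.IsRegular C.subscheme) (I H : X.IdealSheafData) (n : ℕ) (y : X')
    (hcl : IsClosed ({π y} : Set X)) (hpt : (C.support : Set X) = {π y})
    (hIn : stalkIdeal I (π y) ≤ maximalIdeal _ ^ n)
    (hI'1 : stalkIdeal (controlledTransform π C I n) y ≤ maximalIdeal _)
    (h : WInv I H n (π y)) :
    ∃ z' : X'.presheaf.stalk y, stalkIdeal (strictTransformIdeal π C H) y = Ideal.span {z'} ∧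
      z' ∈ maximalIdeal (X'.presheaf.stalk y) ∧ z' ∉ maximalIdeal (X'.presheaf.stalk y) ^ 2 ∧
      ∃ w ∈ stalkIdeal (controlledTransform π C I n) y, ∃ c' : X'.presheaf.stalk y, IsUnit c' ∧
        w - c' * z' ^ n ∈ stalkIdeal (C.comap π) y := by
  obtain ⟨z, hHz, hz1, hz2, f, hfI, c, hc, hfz⟩ := h
  haveI : IsRegularLocalRing (X.presheaf.stalk (π y)) := hX _
  have hCst : stalkIdeal C (π y) = maximalIdeal _ := by
    rw [eq_vanishingIdeal_support_of_isRegular C hCreg]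
    apply stalkIdeal_vanishingIdeal_eq_maximalIdeal_of_closure_eq
    rw [hpt, hcl.closure_eq]
  obtain ⟨𝔷, z', hE, hnzd, hzz', -, hreg⟩ := AbsoluteContactClasses.point_round_chart hπ y hCst hz1 hz2 hHz
  set σ := (π.stalkMap y).hom with hσ
  set t := σ 𝔷 with ht
  -- the exceptional ideal at `y` is `(t) = 𝔪_x · 𝒪_{X',y}`
  have hEm : (maximalIdeal (X.presheaf.stalk (π y))).map σ = Ideal.span {t} := by
    rw [← hCst, ← stalkIdeal_comap_eq_map_stalkMap, hE]
  -- `π^* f = w₀ · t^n` with `w₀ ∈ 𝓘'_y`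
  have hσf : σ f ∈ Ideal.span {t ^ n} := by
    have hm : σ f ∈ (maximalIdeal _ ^ n).map σ := Ideal.mem_map_of_mem _ (hIn hfI)
    rwa [Ideal.map_pow, hEm, Ideal.span_singleton_pow] at hm
  obtain ⟨w₀, hw₀⟩ := Ideal.mem_span_singleton'.mp hσf
  have hI' : stalkIdeal (controlledTransform π C I n) y =
      Submodule.colon ((stalkIdeal I (π y)).map σ) {t ^ n} := by
    rw [hπ.stalkIdeal_controlledTransform I n y, stalkIdeal_comap_eq_map_stalkMap, hE,
      Ideal.span_singleton_pow, Submodule.colon_span]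
  have hw₀I' : w₀ ∈ stalkIdeal (controlledTransform π C I n) y := by
    rw [hI', Submodule.mem_colon_singleton, smul_eq_mul, hw₀]
    exact Ideal.mem_map_of_mem _ hfI
  -- `π^*(f − c z^n) = b · t^{n+1}`
  have hσr : σ (f - c * z ^ n) ∈ Ideal.span {t ^ (n + 1)} := by
    have hm : σ (f - c * z ^ n) ∈ (maximalIdeal _ ^ (n + 1)).map σ := Ideal.mem_map_of_mem _ hfz
    rwa [Ideal.map_pow, hEm, Ideal.span_singleton_pow] at hm
  obtain ⟨b, hb⟩ := Ideal.mem_span_singleton'.mp hσr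
  -- cancel `t^n` (a non-zero-divisor): the new tail is `t · b`
  have hkey : w₀ - σ c * z' ^ n = t * b := by
    have h1 : t ^ n * (w₀ - σ c * z' ^ n) = t ^ n * (t * b) := by
      have e1 : σ (f - c * z ^ n) = σ f - σ c * (t * z') ^ n := by rw [map_sub, map_mul, map_pow, hzz']
      calc t ^ n * (w₀ - σ c * z' ^ n) = w₀ * t ^ n - σ c * (t * z') ^ n := by ring
        _ = σ (f - c * z ^ n) := by rw [e1, hw₀]
        _ = b * t ^ (n + 1) := hb.symm
        _ = t ^ n * (t * b) := by ring
    exact (mul_cancel_left_mem_nonZeroDivisors (pow_mem hnzd n)).mp h1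
  -- TRANSPORT: `z' ∈ 𝔪_y`
  have htm : t ∈ maximalIdeal (X'.presheaf.stalk y) := by
    have h1 : t ∈ (maximalIdeal (X.presheaf.stalk (π y))).map σ := by
      rw [hEm]; exact Ideal.mem_span_singleton_self t
    have hle : (maximalIdeal (X.presheaf.stalk (π y))).map σ ≤ maximalIdeal (X'.presheaf.stalk y) :=
      Ideal.map_le_iff_le_comap.mpr fun a ha => Ideal.mem_comap.mpr (map_nonunit σ a ha)
    exact hle h1
  have hcu : IsUnit (σ c) := hc.map σ
  have hz'n : σ c * z' ^ n ∈ maximalIdeal (X'.presheaf.stalk y) := by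
    have h1 : w₀ - t * b ∈ maximalIdeal _ := sub_mem (hI'1 hw₀I') (Ideal.mul_mem_right _ _ htm)
    have e : w₀ - t * b = σ c * z' ^ n := by rw [← hkey]; ring
    rwa [e] at h1
  have hz'm : z' ∈ maximalIdeal (X'.presheaf.stalk y) :=
    Ideal.IsPrime.mem_of_pow_mem inferInstance n ((Ideal.unit_mul_mem_iff_mem _ hcu).mp hz'n)
  obtain ⟨hz'2, hprime, htz'⟩ := hreg hz'm
  refine ⟨z', ?_, hz'm, hz'2, w₀, hw₀I', σ c, hcu, ?_⟩
  · -- `H'_y = (z')`: the strict transform of the regular hypersurface (verbatim the computation of `absInv_point`)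
    rw [stalkIdeal_strictTransformIdeal π C H y, hHz, Ideal.map_span, Set.image_singleton, hzz', hE]
    apply le_antisymm
    · refine iSup_le fun m => fun a ha => ?_
      have h1 : a * t ^ m ∈ Ideal.span {z'} := by
        have h2 : a * t ^ m ∈ Ideal.span {t * z'} :=
          Submodule.mem_colon.mp ha (t ^ m) (Ideal.pow_mem_pow (Ideal.mem_span_singleton_self _) m)
        exact Ideal.span_singleton_le_iff_mem _ |>.mpr
          (Ideal.mul_mem_left _ t (Ideal.mem_span_singleton_self z')) h2
      rcases hprime.mem_or_mem h1 with h3 | h3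
      · exact h3
      · exact absurd (hprime.mem_of_pow_mem m h3) htz'
    · refine le_iSup_of_le 1 fun a ha => ?_
      obtain ⟨c₁, rfl⟩ := Ideal.mem_span_singleton'.mp ha
      refine Submodule.mem_colon.mpr fun s hs => ?_
      rw [pow_one] at hs
      obtain ⟨b₁, rfl⟩ := Ideal.mem_span_singleton'.mp hs
      rw [smul_eq_mul, show c₁ * z' * (b₁ * t) = (c₁ * b₁) * (t * z') by ring]
      exact Ideal.mul_mem_left _ _ (Ideal.mem_span_singleton_self _)
  · rw [hkey, hE]
    exact Ideal.mul_mem_right _ _ (Ideal.mem_span_singleton_self _)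

/-- **THE KANGAROO DICHOTOMY AT THE NEXT POINT (KERNEL, PROVED)**: under the hypotheses of the transport law, after one point
blow-up the weak-contact invariant EITHER PERSISTS along the strict transform (`WInv 𝓘' H' n y`: no jump) OR there is a TYPED
KANGAROO JUMP at `y` (`TailJumpAt 𝓘' H' 𝓘(E) n y`). (Sources: Hauser2010Kangaroo; Moh1987.) -/
theorem wInv_or_tailJumpAt_point (hπ : IsBlowup π C) [IsLocallyNoetherian X] [IsLocallyNoetherian X']
    (hX : Scheme.IsRegular X) (hCreg : Scheme.IsRegular C.subscheme) (I H : X.IdealSheafData) (n : ℕ) (y : X')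
    (hcl : IsClosed ({π y} : Set X)) (hpt : (C.support : Set X) = {π y})
    (hIn : stalkIdeal I (π y) ≤ maximalIdeal _ ^ n)
    (hI'1 : stalkIdeal (controlledTransform π C I n) y ≤ maximalIdeal _)
    (h : WInv I H n (π y)) :
    WInv (controlledTransform π C I n) (strictTransformIdeal π C H) n y ∨
      TailJumpAt (controlledTransform π C I n) (strictTransformIdeal π C H) (C.comap π) n y := by
  obtain ⟨z', hH', hz'm, hz'2, w, hw, c', hc', hwz⟩ := wInv_point_transport hπ hX hCreg I H n y hcl hpt hIn hI'1 h
  by_cases hj : w - c' * z' ^ n ∈ maximalIdeal (X'.presheaf.stalk y) ^ (n + 1)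
  · exact Or.inl ⟨z', hH', hz'm, hz'2, w, hw, c', hc', hj⟩
  · exact Or.inr ⟨z', hH', hz'm, hz'2, w, hw, c', hc', hwz, hj⟩

/-- the invariant puts the point on the germ: `WInv 𝓘 H n y → y ∈ V(H)`. [folklore] -/
theorem mem_support_of_wInv {Y : Scheme.{uW}} {I H : Y.IdealSheafData} {n : ℕ} {y : Y} (h : WInv I H n y) :
    y ∈ (H.support : Set Y) := by
  obtain ⟨z, hHz, hzm, -, -⟩ := h
  exact (mem_support_iff_stalkIdeal_le _ _).mpr (by rw [hHz]; exact (Ideal.span_singleton_le_iff_mem _).mpr hzm)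

/-- the invariant makes the germ a REGULAR HYPERSURFACE germ: `ord_y H = 1`. [folklore] -/
theorem idealOrder_eq_one_of_wInv {Y : Scheme.{uW}} {I H : Y.IdealSheafData} {n : ℕ} {y : Y} (h : WInv I H n y) :
    idealOrder H y = 1 := by
  obtain ⟨z, hHz, hzm, hz2, -⟩ := h
  refine le_antisymm ?_ ?_
  · by_contra hlt
    rw [not_le] at hlt
    have h2 : ((2 : ℕ) : ℕ∞) ≤ idealOrder H y := by
      have : (1 : ℕ∞) + 1 ≤ idealOrder H y := (ENat.add_one_le_iff (ENat.coe_ne_top 1)).mpr hlt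
      exact_mod_cast this
    rw [le_idealOrder_iff, hHz] at h2
    exact hz2 (h2 (Ideal.mem_span_singleton_self z))
  · rw [show (1 : ℕ∞) = ((1 : ℕ) : ℕ∞) from rfl, le_idealOrder_iff, hHz, pow_one]
    exact (Ideal.span_singleton_le_iff_mem _).mpr hzm

end WeakTransport

end Summit.ResolutionOfSingularities.ResolutionOfSingularities.Theorems.HugValuationCut
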